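import Mathlib.AlgebraicGeometry.Morphisms.Smooth
import HarnessLib

/-!
# The smooth locus is compatible with base change

Topic: `Literature/AlgebraicGeometry/Resolution`. De Jong 1996 works throughout §§4–5 with the
smooth locus `sm(X/S)` of a morphism (2.5: "We write `sm(X/S)` for the open subscheme of `X`
where `f` is smooth [EGA IV 17.3]"; Mathlib `Scheme.Hom.smoothLocus`, the points at which the
stalk map is formally smooth, for `f` locally of finite presentation) and uses at 4.15 that it
only grows under base change: "(vi) e) holds since `φ⁻¹(sm(X/Y)) ⊂ sm(X'/Y')`" (for the base
change `X' ⊂ Y' ×_Y X → Y'` along `Y' → Y`, near smooth points where the fibre product is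
already the strict transform). PROVED here for Mathlib's fibre product:

* `smooth_ι_comp_of_subset_smoothLocus`-type step: a point of the smooth locus has an affine
  open neighbourhood `V` over an affine open `U` of the base with `V → U` smooth (Mathlib
  `exists_smooth_of_formallySmooth_stalk`), i.e. `V ↪ X → S` smooth;
* `Scheme.Hom.preimage_smoothLocus_le_smoothLocus_pullback_snd` — **`pr₁⁻¹(sm(X/S)) ⊆
  sm(X ×_S Y / Y)`**: over such a `V`, `pr₁⁻¹(V) = V ×_S Y → Y` is a base change of the smooth
  `V → S`, hence smooth, hence inside the smooth locus;
* the same for `pullback.fst` as the structure map (`…_pullback_fst`) and for an arbitrary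
  cartesian square (`IsPullback`, `…_of_isPullback`).

## Sources

* A. J. de Jong, *Smoothness, semi-stability and alterations*, Publ. Math. IHÉS 83 (1996), 2.5
  (p. 55), 4.15 (p. 71).
* A. Grothendieck, EGA IV₄ (1967), 17.3.3 (iii) (smoothness is stable under base change),
  17.3 (the smooth locus).
-/

noncomputable section

open CategoryTheory CategoryTheory.Limits AlgebraicGeometry TopologicalSpace

namespace Literature.AlgebraicGeometry.Resolution

universe u

variable {X Y S : Scheme.{u}}

/-- **A point of the smooth locus has an open neighbourhood `V` with `V ↪ X → S` smooth**
(Mathlib `exists_smooth_of_formallySmooth_stalk`: affine `V` over an affine `U` of the base with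
`Γ(U) → Γ(V)` smooth; then `V → U` is smooth and so is `V → U ↪ S`). [folklore] -/
theorem exists_smooth_ι_comp_of_mem_smoothLocus (f : X ⟶ S) [LocallyOfFinitePresentation f]
    {x : X} (hx : x ∈ f.smoothLocus) : ∃ V : X.Opens, x ∈ V ∧ Smooth (V.ι ≫ f) := by
  obtain ⟨U, hU, V, hV, hVU, hxV, H⟩ := exists_smooth_of_formallySmooth_stalk f x hx
  refine ⟨V, hxV, ?_⟩
  haveI : IsAffine _ := hU
  haveI : IsAffine _ := hV
  have hsm : Smooth (f.resLE U V hVU) := by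
    rw [HasRingHomProperty.iff_of_isAffine (P := @Smooth)]
    exact (RingHom.Smooth.propertyIsLocal.respectsIso.arrow_mk_iso_iff
      (arrowResLEAppIso f U V hVU)).mpr H
  rw [← Scheme.Hom.resLE_comp_ι f hVU]
  infer_instance

/-- **The smooth locus only grows under base change**: for `f : X → S` locally of finite
presentation and `g : Y → S`, `pr₁⁻¹(sm(X/S)) ⊆ sm(X ×_S Y / Y)` (de Jong 1996, 4.15:
"`φ⁻¹(sm(X/Y)) ⊂ sm(X'/Y')`"; EGA IV 17.3.3 (iii)). At a point `p` with `pr₁ p` in the smooth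
locus, choose `V ∋ pr₁ p` with `V ↪ X → S` smooth; then `pr₁⁻¹(V) → Y` is a base change of it,
hence smooth, and `p` lies in the smooth locus of `pr₂`. [cite: DeJong1996, 4.15, p. 71] -/
theorem Scheme.Hom.preimage_smoothLocus_le_smoothLocus_pullback_snd (f : X ⟶ S)
    [LocallyOfFinitePresentation f] (g : Y ⟶ S) :
    pullback.fst f g ⁻¹ᵁ f.smoothLocus ≤ (pullback.snd f g).smoothLocus := by
  intro p hp
  obtain ⟨V, hpV, hsm⟩ := exists_smooth_ι_comp_of_mem_smoothLocus f hp
  haveI := hsm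
  -- the open `W = pr₁⁻¹ V` of `X ×_S Y` and `W → Y`, a base change of `V → S`
  let W : (pullback f g).Opens := pullback.fst f g ⁻¹ᵁ V
  have hW : Smooth (W.ι ≫ pullback.snd f g) := by
    -- `V ×_X (X ×_S Y) ≅ V ×_S Y` and `V ×_X (X ×_S Y) ≅ (X ×_S Y) ×_X V ≅ pr₁⁻¹ V`
    let A := pullbackRightPullbackFstIso f g V.ι
    let B := pullbackSymmetry V.ι (pullback.fst f g)
    let C := pullbackRestrictIsoRestrict (pullback.fst f g) V
    have h1 : Smooth (pullback.snd V.ι (pullback.fst f g) ≫ pullback.snd f g) := by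
      rw [← pullbackRightPullbackFstIso_hom_snd f g V.ι]
      infer_instance
    have h2 : pullback.snd V.ι (pullback.fst f g) = (B.hom ≫ C.hom) ≫ W.ι := by
      rw [Category.assoc, pullbackRestrictIsoRestrict_hom_ι, pullbackSymmetry_hom_comp_fst]
    rw [h2, Category.assoc] at h1
    exact (MorphismProperty.cancel_left_of_respectsIso @Smooth (B.hom ≫ C.hom) _).mp h1
  -- hence every point of `W` is in the smooth locus of `pr₂`
  have hW' : (W.ι ≫ pullback.snd f g).smoothLocus = ⊤ := Scheme.Hom.smoothLocus_eq_top _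
  have hpW : (⟨p, hpV⟩ : W) ∈ (W.ι ≫ pullback.snd f g).smoothLocus := hW' ▸ trivial
  rw [← Scheme.Hom.preimage_smoothLocus_eq] at hpW
  exact hpW

/-- The same with the roles of the factors exchanged: `pr₂⁻¹(sm(Y/S)) ⊆ sm(X ×_S Y / X)`.
[folklore] -/
theorem Scheme.Hom.preimage_smoothLocus_le_smoothLocus_pullback_fst (f : X ⟶ S) (g : Y ⟶ S)
    [LocallyOfFinitePresentation g] :
    pullback.snd f g ⁻¹ᵁ g.smoothLocus ≤ (pullback.fst f g).smoothLocus := by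
  intro p hp
  have h := Scheme.Hom.preimage_smoothLocus_le_smoothLocus_pullback_snd g f
    (show (pullbackSymmetry f g).hom p ∈ pullback.fst g f ⁻¹ᵁ g.smoothLocus by
      show pullback.fst g f ((pullbackSymmetry f g).hom p) ∈ g.smoothLocus
      rwa [← Scheme.Hom.comp_apply, pullbackSymmetry_hom_comp_fst])
  -- transport along `X ×_S Y ≅ Y ×_S X`
  have e : (pullbackSymmetry f g).hom ≫ pullback.snd g f = pullback.fst f g :=
    pullbackSymmetry_hom_comp_snd f g
  have h' : p ∈ ((pullbackSymmetry f g).hom ≫ pullback.snd g f).smoothLocus := by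
    rw [← Scheme.Hom.preimage_smoothLocus_eq]
    exact h
  convert h'
  exact e.symm

/-- **Base change of the smooth locus along an arbitrary cartesian square**: if
`fst ≫ f = snd ≫ g` is a pullback square with `f` locally of finite presentation, then
`fst⁻¹(sm(X/S)) ⊆ sm(P/Y)`. [cite: DeJong1996, 4.15, p. 71] -/
theorem Scheme.Hom.preimage_smoothLocus_le_smoothLocus_of_isPullback {P : Scheme.{u}}
    {fst : P ⟶ X} {snd : P ⟶ Y} {f : X ⟶ S} {g : Y ⟶ S} [LocallyOfFinitePresentation f]
    (H : IsPullback fst snd f g) :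
    haveI : LocallyOfFinitePresentation snd := MorphismProperty.of_isPullback H ‹_›
    fst ⁻¹ᵁ f.smoothLocus ≤ snd.smoothLocus := by
  haveI : LocallyOfFinitePresentation snd := MorphismProperty.of_isPullback H ‹_›
  intro p hp
  have h := Scheme.Hom.preimage_smoothLocus_le_smoothLocus_pullback_snd f g
    (show H.isoPullback.hom p ∈ pullback.fst f g ⁻¹ᵁ f.smoothLocus by
      show pullback.fst f g (H.isoPullback.hom p) ∈ f.smoothLocus
      rwa [← Scheme.Hom.comp_apply, IsPullback.isoPullback_hom_fst])
  have e : H.isoPullback.hom ≫ pullback.snd f g = snd := IsPullback.isoPullback_hom_snd H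
  have h' : p ∈ (H.isoPullback.hom ≫ pullback.snd f g).smoothLocus := by
    rw [← Scheme.Hom.preimage_smoothLocus_eq]
    exact h
  convert h'
  exact e.symm

end Literature.AlgebraicGeometry.Resolution

end
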